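import Mathlib
import HarnessLib
import Summits.NavierStokesRegularity.NavierStokesRegularity.Theorems.UnthreadedRigidityDoorUnthreadedRigidityVirialHornOrderTwoLaw
import Summits.NavierStokesRegularity.NavierStokesRegularity.Theorems.UnthreadedRigidityDoorUnthreadedRigidityPersistenceLambCurlIdentity
import Summits.NavierStokesRegularity.NavierStokesRegularity.Theorems.UnthreadedRigidityDoorUnthreadedRigidityPersistenceSphereLawCore

/-!
# Route `UnthreadedRigidityDoor`, wall item W2 `UnthreadedRigidity` (stmt-NavierStokesRegularity-27585) — LINE g12-2 «PERSISTENCE FILTER»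
# (ns-idea-6 g12, `Persistence_sketch.lean` 09bc8f71301208c4; idea-crit-7 PASS B+): ★ support S–M «SPHERE LAW» `BalanceSphereLaw`, VERBATIM
# (the sketch-local `lambPot` / `balAmp` unfolded)

Seat ns-es-p1 g9.  DATA statement about the Lamb-curl potential `ψ(y) = −K(|y|)α(|y|)|∇Y(y)|² + b_l[H](|y|) Y(y)²` of a single shell
(`K = vortAmpL l H`, `α = strainAmpL l H`, `b_l[H](r) = (l/2r)((l−1)KH′ − (l+1)K′H)`): if `∇ψ × y = e(|y|) ∇Y × y` off the origin, then
(A) `b_l[H] ≡ 0` on `(0,∞)` and (B) at every radius with `Kα ≠ 0`, `|∇Y|²` is affine in `Y` on the unit sphere.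

PROOF.  Fix `r > 0` and put `F = ψ − e(r)·Y`.  On the sphere `S_r`, `∇F × y = 0` (the hypothesis with `|y| = r`), so `F` is CONSTANT on `S_r`
(`eq_of_cross_gradient_eq_zero_on_sphere`; `ψ` is differentiable off the origin because the profile is smooth-even, `differentiableAt_lambPot`).
Transporting to `S²` by homogeneity (`Y(ru) = r^l Y(u)`, `∇Y(ru) = r^{l−1}∇Y(u)`):
`b_l(r) r^{2l} Y(u)² = Kα(r) r^{2l−2}|∇Y(u)|² + e(r) r^l Y(u) + C(r)` for all `u ∈ S²`.  If `b_l(r) ≠ 0` this is a sphere relation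
`Y² = p|∇Y|² + qY + c₀`, impossible for a nonzero solid harmonic (`no_sphere_relation`, the Cartan-routed core) — (A); and with `b_l(r) = 0`,
`Kα(r) ≠ 0` it reads `|∇Y(u)|² = aY(u) + c` — (B).

HONEST LABEL: elementary support of a files-only RUNG line about SPECIAL single-shell data; nothing here bears on `UnthreadedRigidity` (27585),
the door Target, W2 or Navier–Stokes regularity; no summit statement is proved.  MODEL/rung work; 0 kit.  [folklore]
-/

noncomputable section

-- the summit and its single sub-problem share the name (CONVENTIONS §1), as in every Theorems file
set_option linter.dupNamespace false

namespace Summit.NavierStokesRegularity.NavierStokesRegularity.Theorems.UnthreadedRigidity.Persistence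

open Set Function Filter Topology
open scoped RealInnerProductSpace
open Literature.Analysis.FluidPDE (cross cross_smul_left)
open Summit.NavierStokesRegularity.NavierStokesRegularity.Theorems.UnthreadedRigidity.ProfileHorn (E3)
open Summit.NavierStokesRegularity.NavierStokesRegularity.Theorems.UnthreadedRigidity.VirialHorn

/-! ## §1 The potential is differentiable off the origin -/

/-- The radial amplitudes of a smooth-even profile `H(r) = h(r²)` are differentiable at every `r₀ > 0`: `H`, `H′`, `K = vortAmpL l H`, `K′`,
`α = strainAmpL l H` (they agree near `r₀` with smooth functions of `r²`). [folklore] -/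
theorem differentiableAt_amplitudes (l : ℕ) {H h : ℝ → ℝ} (hh : ContDiff ℝ (⊤ : ℕ∞) h) (hHh : ∀ r : ℝ, 0 ≤ r → H r = h (r ^ 2))
    {r₀ : ℝ} (hr₀ : 0 < r₀) :
    DifferentiableAt ℝ H r₀ ∧ DifferentiableAt ℝ (deriv H) r₀ ∧ DifferentiableAt ℝ (vortAmpL l H) r₀ ∧
      DifferentiableAt ℝ (deriv (vortAmpL l H)) r₀ ∧ DifferentiableAt ℝ (strainAmpL l H) r₀ := by
  have hh' : ContDiff ℝ (⊤ : ℕ∞) (deriv h) := contDiff_deriv_of_contDiff_top hh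
  have hh'' : ContDiff ℝ (⊤ : ℕ∞) (deriv (deriv h)) := contDiff_deriv_of_contDiff_top hh'
  have hd0 : Differentiable ℝ h := hh.differentiable (by simp)
  have hd1 : Differentiable ℝ (deriv h) := hh'.differentiable (by simp)
  obtain ⟨c, hc_def⟩ : ∃ c : ℝ → ℝ, c = fun s => 4 * s * deriv (deriv h) s + (4 * (l : ℝ) + 6) * deriv h s := ⟨_, rfl⟩
  have hc : ContDiff ℝ (⊤ : ℕ∞) c := by
    rw [hc_def]
    exact ((contDiff_const.mul contDiff_id).mul hh'').add (contDiff_const.mul hh')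
  have hcd : Differentiable ℝ c := hc.differentiable (by simp)
  have hc'd : Differentiable ℝ (deriv c) := (contDiff_deriv_of_contDiff_top hc).differentiable (by simp)
  have hsq : Differentiable ℝ (fun r : ℝ => r ^ 2) := differentiable_pow 2
  have hnhds : ∀ᶠ r in 𝓝 r₀, 0 < r := Ioi_mem_nhds hr₀
  -- `H`
  have hev0 : H =ᶠ[𝓝 r₀] fun r => h (r ^ 2) := hnhds.mono fun r hr => hHh r hr.le
  have hH0 : DifferentiableAt ℝ H r₀ := hev0.differentiableAt_iff.2 ((hd0.comp hsq) r₀)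
  -- `H′`
  have hev1 : deriv H =ᶠ[𝓝 r₀] fun r => 2 * r * deriv h (r ^ 2) := hnhds.mono fun r hr => deriv_profile_of_sq hh hHh hr
  have hH1 : DifferentiableAt ℝ (deriv H) r₀ :=
    hev1.differentiableAt_iff.2 ((((differentiable_const _).mul differentiable_id).mul (hd1.comp hsq)) r₀)
  -- `K`
  have hevK : vortAmpL l H =ᶠ[𝓝 r₀] fun r => c (r ^ 2) := hnhds.mono fun r hr => by
    rw [vortAmpL_eq_of_sq l hh hHh hr, hc_def]
  have hK : DifferentiableAt ℝ (vortAmpL l H) r₀ := hevK.differentiableAt_iff.2 ((hcd.comp hsq) r₀)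
  -- `K′`
  have hevK' : deriv (vortAmpL l H) =ᶠ[𝓝 r₀] fun r => 2 * r * deriv c (r ^ 2) := hnhds.mono fun r hr => by
    rw [deriv_vortAmpL_of_sq l hh hHh hr, hc_def]
  have hK' : DifferentiableAt ℝ (deriv (vortAmpL l H)) r₀ :=
    hevK'.differentiableAt_iff.2 ((((differentiable_const _).mul differentiable_id).mul (hc'd.comp hsq)) r₀)
  -- `α`
  have hα : DifferentiableAt ℝ (strainAmpL l H) r₀ := by
    show DifferentiableAt ℝ (fun r => r * deriv H r + ((l : ℝ) + 1) * H r) r₀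
    exact (differentiableAt_id.mul hH1).add (hH0.const_mul _)
  exact ⟨hH0, hH1, hK, hK', hα⟩

/-- THE LAMB-CURL POTENTIAL `ψ` IS DIFFERENTIABLE OFF THE ORIGIN (virial-admissible profile, solid harmonic `Y`). [folklore] -/
theorem differentiableAt_lambPot (l : ℕ) {H : ℝ → ℝ} {Y : E3 → ℝ} (hH : VirialAdmissible l H) (hY : IsSolidHarmonic l Y)
    {y : E3} (hy : y ≠ 0) :
    DifferentiableAt ℝ (fun y => -(vortAmpL l H ‖y‖ * strainAmpL l H ‖y‖) * ‖gradient Y y‖ ^ 2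
      + (l : ℝ) / (2 * ‖y‖) * (((l : ℝ) - 1) * vortAmpL l H ‖y‖ * deriv H ‖y‖
          - ((l : ℝ) + 1) * deriv (vortAmpL l H) ‖y‖ * H ‖y‖) * Y y ^ 2) y := by
  obtain ⟨h, hh, hHh⟩ := hH.1
  have hr₀ : 0 < ‖y‖ := norm_pos_iff.2 hy
  obtain ⟨hH0, hH1, hK, hK', hα⟩ := differentiableAt_amplitudes l hh hHh hr₀
  have hYd : Differentiable ℝ Y := hY.contDiff.differentiable (by simp)
  have hGn : Differentiable ℝ (fun z : E3 => ‖gradient Y z‖ ^ 2) :=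
    (hY.contDiff_gradient.differentiable (by simp)).norm_sq ℝ
  have hn : DifferentiableAt ℝ (fun z : E3 => ‖z‖) y := differentiableAt_id.norm ℝ hy
  -- the radial scalar factors as functions of `r`
  have hΦ : DifferentiableAt ℝ (fun r => -(vortAmpL l H r * strainAmpL l H r)) ‖y‖ := (hK.mul hα).neg
  have hΨ : DifferentiableAt ℝ (fun r => (l : ℝ) / (2 * r) * (((l : ℝ) - 1) * vortAmpL l H r * deriv H r
      - ((l : ℝ) + 1) * deriv (vortAmpL l H) r * H r)) ‖y‖ := by
    have hdiv : DifferentiableAt ℝ (fun r : ℝ => (l : ℝ) / (2 * r)) ‖y‖ :=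
      (differentiableAt_const _).div (differentiableAt_id.const_mul 2) (mul_ne_zero two_ne_zero hr₀.ne')
    exact hdiv.mul (((( differentiableAt_const _).mul hK).mul hH1).sub (((differentiableAt_const _).mul hK').mul hH0))
  exact ((hΦ.comp y hn).mul (hGn y)).add ((hΨ.comp y hn).mul ((hYd y).fun_pow 2))

/-! ## §2 Constancy on spheres and transport to `S²` -/

/-- ON EACH SPHERE THE BALANCED POTENTIAL IS CONSTANT UP TO `e(r)·Y`, TRANSPORTED TO `S²`: under the hypothesis of `BalanceSphereLaw`, for every
`r > 0` there is `C` with `−K(r)α(r)·(r^{l−1})²|∇Y(u)|² + b_l(r)·(r^l)² Y(u)² − e(r) r^l Y(u) = C` for all unit `u`. [folklore] -/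
theorem sphere_transport {l : ℕ} {H : ℝ → ℝ} {Y : E3 → ℝ} {e : ℝ → ℝ} (hY : IsSolidHarmonic l Y) (hH : VirialAdmissible l H)
    (hbal : ∀ y : E3, y ≠ 0 →
      cross (gradient (fun y => -(vortAmpL l H ‖y‖ * strainAmpL l H ‖y‖) * ‖gradient Y y‖ ^ 2
          + (l : ℝ) / (2 * ‖y‖) * (((l : ℝ) - 1) * vortAmpL l H ‖y‖ * deriv H ‖y‖
              - ((l : ℝ) + 1) * deriv (vortAmpL l H) ‖y‖ * H ‖y‖) * Y y ^ 2) y) y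
        = e ‖y‖ • cross (gradient Y y) y)
    {r : ℝ} (hr : 0 < r) :
    ∃ C : ℝ, ∀ u : E3, ‖u‖ = 1 →
      -(vortAmpL l H r * strainAmpL l H r) * (r ^ ((l : ℤ) - 1)) ^ 2 * ‖gradient Y u‖ ^ 2
        + (l : ℝ) / (2 * r) * (((l : ℝ) - 1) * vortAmpL l H r * deriv H r - ((l : ℝ) + 1) * deriv (vortAmpL l H) r * H r)
            * (r ^ l) ^ 2 * Y u ^ 2
        - e r * r ^ l * Y u = C := by
  have hYd : Differentiable ℝ Y := hY.contDiff.differentiable (by simp)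
  -- the potential and `F = ψ − e(r) Y`
  set ψ : E3 → ℝ := fun y => -(vortAmpL l H ‖y‖ * strainAmpL l H ‖y‖) * ‖gradient Y y‖ ^ 2
      + (l : ℝ) / (2 * ‖y‖) * (((l : ℝ) - 1) * vortAmpL l H ‖y‖ * deriv H ‖y‖
          - ((l : ℝ) + 1) * deriv (vortAmpL l H) ‖y‖ * H ‖y‖) * Y y ^ 2 with hψ
  set F : E3 → ℝ := fun y => ψ y - e r * Y y with hF
  have hψd : ∀ y : E3, ‖y‖ = r → DifferentiableAt ℝ ψ y := fun y hy =>
    differentiableAt_lambPot l hH hY (by rw [← norm_ne_zero_iff, hy]; exact hr.ne')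
  have hFd : ∀ y : E3, ‖y‖ = r → DifferentiableAt ℝ F y := fun y hy => (hψd y hy).sub ((hYd y).const_mul _)
  have hFrad : ∀ y : E3, ‖y‖ = r → cross (gradient F y) y = 0 := by
    intro y hy
    have hy0 : y ≠ 0 := by rw [← norm_ne_zero_iff, hy]; exact hr.ne'
    have hgrad : gradient F y = gradient ψ y - (e r) • gradient Y y := by
      rw [hF, gradient, fderiv_fun_sub (hψd y hy) ((hYd y).const_mul _), fderiv_const_mul (hYd y), map_sub, map_smul]
      rfl
    have h := hbal y hy0
    rw [hy] at h
    have hsub : cross (gradient ψ y - (e r) • gradient Y y) y = cross (gradient ψ y) y - (e r) • cross (gradient Y y) y := by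
      rw [← Literature.Analysis.FluidPDE.crossCLM_apply (gradient ψ y - (e r) • gradient Y y) y, map_sub, map_smul]
      rfl
    rw [hgrad, hsub, h, sub_self]
  -- constant on `S_r`
  obtain ⟨b₀, hb₀, -, -⟩ := Polyhedral.exists_perp_perp (0 : E3) (0 : E3)
  have hb₀n : ‖b₀‖ ≠ 0 := norm_ne_zero_iff.2 hb₀
  set u₀ : E3 := (‖b₀‖⁻¹ : ℝ) • b₀ with hu₀
  have hu₀n : ‖u₀‖ = 1 := by rw [hu₀, norm_smul, norm_inv, norm_norm, inv_mul_cancel₀ hb₀n]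
  have hru : ∀ u : E3, ‖u‖ = 1 → ‖(r : ℝ) • u‖ = r := fun u hu => by
    rw [norm_smul, Real.norm_eq_abs, abs_of_pos hr, hu, mul_one]
  refine ⟨F (r • u₀), fun u hu => ?_⟩
  have hconst : F (r • u) = F (r • u₀) := eq_of_cross_gradient_eq_zero_on_sphere hr hFd hFrad (hru u hu) (hru u₀ hu₀n)
  -- transport: `F(r u)` explicitly
  have hYs : Y (r • u) = r ^ l * Y u := hY.apply_smul r u
  have hGs : ‖gradient Y (r • u)‖ ^ 2 = (r ^ ((l : ℤ) - 1)) ^ 2 * ‖gradient Y u‖ ^ 2 := by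
    rw [hY.gradient_smul r hr u, norm_smul, mul_pow, Real.norm_eq_abs, sq_abs]
  have hval : F (r • u) = -(vortAmpL l H r * strainAmpL l H r) * (r ^ ((l : ℤ) - 1)) ^ 2 * ‖gradient Y u‖ ^ 2
      + (l : ℝ) / (2 * r) * (((l : ℝ) - 1) * vortAmpL l H r * deriv H r - ((l : ℝ) + 1) * deriv (vortAmpL l H) r * H r)
          * (r ^ l) ^ 2 * Y u ^ 2
      - e r * r ^ l * Y u := by
    rw [hF, hψ]
    simp only [hru u hu, hYs, hGs]
    ring
  rw [← hval, hconst]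

/-! ## §3 ★ `BalanceSphereLaw`, VERBATIM -/

/-- ★ **Support S–M «SPHERE LAW» — the sketch's `BalanceSphereLaw` VERBATIM** (sketch-local `lambPot`, `balAmp` unfolded): if
`∇ψ × y = e(|y|) ∇Y × y` off the origin for the Lamb-curl potential `ψ` of an admissible single shell over a nonzero solid harmonic of degree
`l ≥ 1`, then `b_l[H] ≡ 0` on `(0,∞)` and, at every radius where `Kα ≠ 0`, `|∇Y|²` is affine in `Y` on the unit sphere (module docstring). -/
theorem balanceSphereLaw :
    ∀ (l : ℕ) (H : ℝ → ℝ) (Y : E3 → ℝ) (e : ℝ → ℝ), 1 ≤ l → IsSolidHarmonic l Y → (∃ y, Y y ≠ 0) → VirialAdmissible l H →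
      (∀ y : E3, y ≠ 0 →
        cross (gradient (fun y => -(vortAmpL l H ‖y‖ * strainAmpL l H ‖y‖) * ‖gradient Y y‖ ^ 2
            + (l : ℝ) / (2 * ‖y‖) * (((l : ℝ) - 1) * vortAmpL l H ‖y‖ * deriv H ‖y‖
                - ((l : ℝ) + 1) * deriv (vortAmpL l H) ‖y‖ * H ‖y‖) * Y y ^ 2) y) y
          = e ‖y‖ • cross (gradient Y y) y) →
      (∀ r : ℝ, 0 < r → (l : ℝ) / (2 * r) * (((l : ℝ) - 1) * vortAmpL l H r * deriv H r
          - ((l : ℝ) + 1) * deriv (vortAmpL l H) r * H r) = 0) ∧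
        ∀ r : ℝ, 0 < r → vortAmpL l H r * strainAmpL l H r ≠ 0 →
          ∃ a c : ℝ, ∀ y : E3, ‖y‖ = 1 → ‖gradient Y y‖ ^ 2 = a * Y y + c := by
  intro l H Y e hl hY hYne hH hbal
  -- (A): the balance amplitude vanishes at every radius
  have hA : ∀ r : ℝ, 0 < r → (l : ℝ) / (2 * r) * (((l : ℝ) - 1) * vortAmpL l H r * deriv H r
      - ((l : ℝ) + 1) * deriv (vortAmpL l H) r * H r) = 0 := by
    intro r hr
    obtain ⟨C, hC⟩ := sphere_transport hY hH hbal hr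
    set bl : ℝ := (l : ℝ) / (2 * r) * (((l : ℝ) - 1) * vortAmpL l H r * deriv H r
      - ((l : ℝ) + 1) * deriv (vortAmpL l H) r * H r) with hbl
    by_contra hne
    have hrl : (r ^ l) ^ 2 ≠ 0 := pow_ne_zero 2 (pow_ne_zero l hr.ne')
    have hden : bl * (r ^ l) ^ 2 ≠ 0 := mul_ne_zero hne hrl
    -- the sphere relation `Y² = p|∇Y|² + qY + c₀`
    have hrel : ∀ u : E3, ‖u‖ = 1 →
        Y u ^ 2 = (vortAmpL l H r * strainAmpL l H r * (r ^ ((l : ℤ) - 1)) ^ 2) / (bl * (r ^ l) ^ 2) * ‖gradient Y u‖ ^ 2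
          + (e r * r ^ l) / (bl * (r ^ l) ^ 2) * Y u + C / (bl * (r ^ l) ^ 2) := by
      intro u hu
      have h := hC u hu
      rw [div_mul_eq_mul_div, div_mul_eq_mul_div, ← add_div, ← add_div, eq_div_iff hden]
      linear_combination h
    exact no_sphere_relation hl hY hYne hrel
  refine ⟨hA, fun r hr hKα => ?_⟩
  -- (B): with `b_l(r) = 0` the constancy reads `|∇Y(u)|² = aY(u) + c`
  obtain ⟨C, hC⟩ := sphere_transport hY hH hbal hr
  have hpow : (r ^ ((l : ℤ) - 1)) ^ 2 ≠ 0 := pow_ne_zero 2 (zpow_ne_zero _ hr.ne')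
  have hden : vortAmpL l H r * strainAmpL l H r * (r ^ ((l : ℤ) - 1)) ^ 2 ≠ 0 := mul_ne_zero hKα hpow
  refine ⟨-(e r * r ^ l) / (vortAmpL l H r * strainAmpL l H r * (r ^ ((l : ℤ) - 1)) ^ 2),
    -C / (vortAmpL l H r * strainAmpL l H r * (r ^ ((l : ℤ) - 1)) ^ 2), fun u hu => ?_⟩
  have h := hC u hu
  rw [hA r hr] at h
  rw [div_mul_eq_mul_div, ← add_div, eq_div_iff hden]
  linear_combination (-1 : ℝ) * h

end Summit.NavierStokesRegularity.NavierStokesRegularity.Theorems.UnthreadedRigidity.Persistence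

end
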